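import Mathlib
import HarnessLib
import Summits.AtomisticToContinuum.Crystallization.Theses.EnergyDerivativeOrder
import Summits.AtomisticToContinuum.Crystallization.Theorems.EnergyDerivativeOrderLimitTransferHcpShells

/-!
# Line `shells-split` for crux C2 `SpectralRigidityHcp` (stmt-AtomisticToContinuum-12278, route
# EnergyDerivativeOrder) — registered skeleton (crux-strategist 2026-08-17)

Three registered stubs = the three pieces of the typed decomposition (LOCAL shell classification /
LOCAL-TO-GLOBAL layer propagation / ARITHMETIC stacking selection — Hales's "kissing-twelve ⇒
hexagonal layers" architecture transplanted from contact data to distance-spectrum data and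
relaxed to `hcp(a,h)`), and the kernel-checked composition `SpectralRigidityHcp_of` concluding the
crux BY NAME (sorry-free; the same proof as `Cruxes/SpectralRigidityHcp/StrategySplit.lean`):
it computes the bottom of the relaxed hcp spectrum in the window, recentres every punctured
`6a/5`-neighbourhood to a twelve-point two-radius spectral set, feeds P1 then P2, transports the
spectral hypothesis through the isometry of P2, applies P3 and composes the isometries.
Card: `Lines/shells-split.md`.  Per-stub birth skeletons: `Lines/<Piece>_birth.lean`.
-/

noncomputable section

namespace Summit.AtomisticToContinuum.Crystallization.Cruxes.SpectralRigidityHcp.ShellsSplit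

open Literature.MathematicalPhysics.StatisticalMechanics
open Summit.AtomisticToContinuum.Crystallization.Theses.EnergyDerivativeOrder
open Summit.AtomisticToContinuum.Crystallization.Theorems.EnergyDerivativeOrderLimitTransfer
open Set Metric

/-! ## The three registered stubs (= the pieces P1, P2, P3 of the route-level split; each crux-sized) -/

/-- STUB P1 — TWO-RADIUS SHELL PATTERNS (local, finite classification; L): a twelve-point set with
radii in `{a, a'}` and mutual distances in the hcp spectrum is a rotated hcp or fcc first shell.
Birth skeleton: `Lines/TwoRadiusShellPatterns_birth.lean` (ideal code classification /
non-ideal two-radius classification). -/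
theorem stub_twoRadiusShellPatterns :
    ∀ a h : ℝ, 0 < a → |h / a - Real.sqrt (2 / 3)| ≤ 1 / 400 → ∀ T : Set (EuclideanSpace ℝ (Fin 3)), T.ncard = 12 → (∀ t ∈ T, dist 0 t = a ∨ dist 0 t = Real.sqrt (a ^ 2 / 3 + h ^ 2)) → (∀ t ∈ T, ∀ t' ∈ T, t ≠ t' → ∃ p ∈ hcpStacking a h, ∃ q ∈ hcpStacking a h, dist t t' = dist p q) → ∃ A : EuclideanSpace ℝ (Fin 3) →ₗᵢ[ℝ] EuclideanSpace ℝ (Fin 3), T = A '' {p ∈ hcpStacking a h | p ≠ 0 ∧ dist 0 p ≤ 6 / 5 * a} ∨ T = A '' {p ∈ fccStacking a h | p ≠ 0 ∧ dist 0 p ≤ 6 / 5 * a} := by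
  sorry

/-- STUB P2 — SHELLS PROPAGATE TO A BARLOW STACKING (local-to-global, Hales DSP §1.3 relaxed; L).
Birth skeleton: `Lines/ShellsPropagateToBarlow_birth.lean` (first layer / layer-to-stacking). -/
theorem stub_shellsPropagateToBarlow :
    ∀ a h : ℝ, 0 < a → |h / a - Real.sqrt (2 / 3)| ≤ 1 / 400 → ∀ Y : Set (EuclideanSpace ℝ (Fin 3)), Y.Nonempty → (∀ y ∈ Y, ∃ A : EuclideanSpace ℝ (Fin 3) →ₗᵢ[ℝ] EuclideanSpace ℝ (Fin 3), {y' ∈ Y | y' ≠ y ∧ dist y y' ≤ 6 / 5 * a} = (fun p => y + A p) '' {p ∈ hcpStacking a h | p ≠ 0 ∧ dist 0 p ≤ 6 / 5 * a} ∨ {y' ∈ Y | y' ≠ y ∧ dist y y' ≤ 6 / 5 * a} = (fun p => y + A p) '' {p ∈ fccStacking a h | p ≠ 0 ∧ dist 0 p ≤ 6 / 5 * a}) → ∃ s : ℤ → ℤ, IsHaggSeq s ∧ ∃ g : EuclideanSpace ℝ (Fin 3) ≃ᵢ EuclideanSpace ℝ (Fin 3), Y = g '' barlowStacking a h s := by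
  sorry

/-- STUB P3 — THE SPECTRUM SELECTS hcp AMONG BARLOW STACKINGS (arithmetic; M).
Birth skeleton: `Lines/SpectrumSelectsHcp_birth.lean` (cubic-triple witness / spectrum arithmetic /
sign-flip congruence). -/
theorem stub_spectrumSelectsHcp :
    ∀ a h : ℝ, 0 < a → |h / a - Real.sqrt (2 / 3)| ≤ 1 / 400 → ∀ s : ℤ → ℤ, IsHaggSeq s → (∀ p ∈ barlowStacking a h s, ∀ q ∈ barlowStacking a h s, p ≠ q → ∃ p' ∈ hcpStacking a h, ∃ q' ∈ hcpStacking a h, dist p q = dist p' q') → ∃ g : EuclideanSpace ℝ (Fin 3) ≃ᵢ EuclideanSpace ℝ (Fin 3), barlowStacking a h s = g '' hcpStacking a h := by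
  sorry

/-! ## Glue (PROVED) -/

/-- **Window numerics.** In the window `|h/a − √(2/3)| ≤ 1/400` (`a > 0`): `h > 0`, and the
radius `6a/5` is below the three second-shell bounds `3a²`, `4a²/3 + h²`, `4h²` of a relaxed
Barlow stacking (`√(2/3) > 0.8164`, so `h ≥ 0.8139 a`). [folklore] -/
theorem window_second_shell_bounds {a h : ℝ} (ha : 0 < a)
    (hwin : |h / a - Real.sqrt (2 / 3)| ≤ 1 / 400) :
    0 < h ∧ (6 / 5 * a) ^ 2 < 3 * a ^ 2 ∧ (6 / 5 * a) ^ 2 < 4 * a ^ 2 / 3 + h ^ 2 ∧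
      (6 / 5 * a) ^ 2 < 4 * h ^ 2 := by
  have hs1 : (8164 / 10000 : ℝ) < Real.sqrt (2 / 3) := by
    rw [Real.lt_sqrt (by norm_num)]; norm_num
  have hlow : (8139 / 10000 : ℝ) ≤ h / a := by
    have := (abs_le.1 hwin).1
    linarith
  have hha : (8139 / 10000 : ℝ) * a ≤ h := by
    rwa [le_div_iff₀ ha] at hlow
  have hh : 0 < h := lt_of_lt_of_le (by positivity) hha
  refine ⟨hh, by nlinarith, by nlinarith, by nlinarith⟩

/-- **Bottom of the relaxed hcp spectrum.** In the window, two distinct sites of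
`hcpStacking a h` at distance `≤ 6a/5` are first-shell neighbours: their distance is `a` or
`a' = √(a²/3 + h²)` (`dist_sq_cases_of_mem`: `a²`, `a²/3 + h²`, or beyond a second-shell bound).
[folklore] -/
theorem hcp_dist_eq_of_le_window {a h : ℝ} (ha : 0 < a)
    (hwin : |h / a - Real.sqrt (2 / 3)| ≤ 1 / 400) {p q : EuclideanSpace ℝ (Fin 3)}
    (hp : p ∈ hcpStacking a h) (hq : q ∈ hcpStacking a h) (hpq : p ≠ q)
    (hle : dist p q ≤ 6 / 5 * a) :
    dist p q = a ∨ dist p q = Real.sqrt (a ^ 2 / 3 + h ^ 2) := by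
  obtain ⟨-, h1, h2, h3⟩ := window_second_shell_bounds ha hwin
  have hd2 : dist p q ^ 2 ≤ (6 / 5 * a) ^ 2 := pow_le_pow_left₀ dist_nonneg hle 2
  rcases dist_sq_cases_of_mem (a := a) (h := h) isHaggSeq_alternating hp hq hpq with hd | hd | hbig
  · left
    rw [← Real.sqrt_sq (dist_nonneg (x := p) (y := q)), hd, Real.sqrt_sq ha.le]
  · right
    rw [← Real.sqrt_sq (dist_nonneg (x := p) (y := q)), hd]
  · exfalso
    rcases hbig with hb | hb | hb <;> linarith

/-- **Skeleton composition** (kernel-checked, sorry-free itself): the crux `SpectralRigidityHcp` BY NAME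
from the three registered stubs P1 `stub_twoRadiusShellPatterns`, P2 `stub_shellsPropagateToBarlow`,
P3 `stub_spectrumSelectsHcp` (same proof as the hypotheses-form glue
`Cruxes/SpectralRigidityHcp/StrategySplit.lean :: energyDerivativeOrder_spectralRigidityHcp_of_subs`).
Proof: bottom of the spectrum (`hcp_dist_eq_of_le_window`) ⇒ every punctured `6a/5`-neighbourhood,
recentred, is a twelve-point two-radius set with spectral mutual distances ⇒ (P1) a rotated hcp/fcc
first shell ⇒ (P2) `Y = g '' barlowStacking a h s` ⇒ the spectral hypothesis pulls back through
`g` ⇒ (P3) `barlowStacking a h s = g' '' hcpStacking a h` ⇒ `Y = (g' ≫ g) '' hcpStacking a h`.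
[cite: HalesDSP2012, §1.3] -/
theorem SpectralRigidityHcp_of :
    Summit.AtomisticToContinuum.Crystallization.Theses.EnergyDerivativeOrder.SpectralRigidityHcp := by
  intro a h ha hwin Y hY hD hN
  -- Step 1 (local data, recentred): every punctured `6a/5`-neighbourhood, translated to the
  -- origin, is a twelve-point two-radius set with mutual distances in the hcp spectrum, hence
  -- (P1) a rotated copy of the hcp or of the fcc first shell.
  have hshell : ∀ y ∈ Y, ∃ A : EuclideanSpace ℝ (Fin 3) →ₗᵢ[ℝ] EuclideanSpace ℝ (Fin 3),
      {y' ∈ Y | y' ≠ y ∧ dist y y' ≤ 6 / 5 * a} =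
          (fun p => y + A p) '' {p ∈ hcpStacking a h | p ≠ 0 ∧ dist 0 p ≤ 6 / 5 * a} ∨
        {y' ∈ Y | y' ≠ y ∧ dist y y' ≤ 6 / 5 * a} =
          (fun p => y + A p) '' {p ∈ fccStacking a h | p ≠ 0 ∧ dist 0 p ≤ 6 / 5 * a} := by
    intro y hy
    set N : Set (EuclideanSpace ℝ (Fin 3)) := {y' ∈ Y | y' ≠ y ∧ dist y y' ≤ 6 / 5 * a}
      with hNdef
    set T : Set (EuclideanSpace ℝ (Fin 3)) := (fun y' => y' - y) '' N with hTdef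
    -- twelve points (translation is injective)
    have hTcard : T.ncard = 12 := by
      rw [hTdef, Set.ncard_image_of_injective _ sub_left_injective]
      exact hN y hy
    -- radii `a` or `a'`: the distance to the centre is a realised hcp distance `≤ 6a/5`
    have hTrad : ∀ t ∈ T, dist 0 t = a ∨ dist 0 t = Real.sqrt (a ^ 2 / 3 + h ^ 2) := by
      rintro _ ⟨y', ⟨hy'Y, hne, hle⟩, rfl⟩
      have hd : dist (0 : EuclideanSpace ℝ (Fin 3)) (y' - y) = dist y y' := by
        rw [dist_comm, dist_zero_right, ← dist_eq_norm, dist_comm]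
      obtain ⟨p, hp, q, hq, hpq⟩ := hD y hy y' hy'Y (Ne.symm hne)
      have hpq' : p ≠ q := by
        rintro rfl
        rw [dist_self, dist_eq_zero] at hpq
        exact hne hpq.symm
      rw [hd, hpq]
      exact hcp_dist_eq_of_le_window ha hwin hp hq hpq' (hpq ▸ hle)
    -- mutual distances are realised hcp distances (translation invariance)
    have hTdist : ∀ t ∈ T, ∀ t' ∈ T, t ≠ t' →
        ∃ p ∈ hcpStacking a h, ∃ q ∈ hcpStacking a h, dist t t' = dist p q := by
      rintro _ ⟨y₁, ⟨h₁Y, -, -⟩, rfl⟩ _ ⟨y₂, ⟨h₂Y, -, -⟩, rfl⟩ hne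
      have h12 : y₁ ≠ y₂ := fun h0 => hne (by rw [h0])
      obtain ⟨p, hp, q, hq, hpq⟩ := hD y₁ h₁Y y₂ h₂Y h12
      refine ⟨p, hp, q, hq, ?_⟩
      rw [← hpq, dist_eq_norm, dist_eq_norm, sub_sub_sub_cancel_right]
    -- P1, then translate back
    obtain ⟨A, hA⟩ := stub_twoRadiusShellPatterns a h ha hwin T hTcard hTrad hTdist
    have hNT : (fun t => y + t) '' T = N := by
      rw [hTdef, Set.image_image]
      simp
    refine ⟨A, ?_⟩
    rcases hA with hA | hA
    · left
      rw [← hNT, hA, Set.image_image]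
    · right
      rw [← hNT, hA, Set.image_image]
  -- Step 2 (local-to-global, P2): `Y` is an isometric image of a Barlow stacking.
  obtain ⟨s, hs, g, hYg⟩ := stub_shellsPropagateToBarlow a h ha hwin Y hY hshell
  -- Step 3: the spectral hypothesis pulls back through the isometry `g` …
  have hdistS : ∀ p ∈ barlowStacking a h s, ∀ q ∈ barlowStacking a h s, p ≠ q →
      ∃ p' ∈ hcpStacking a h, ∃ q' ∈ hcpStacking a h, dist p q = dist p' q' := by
    intro p hp q hq hpq
    have hgp : g p ∈ Y := by rw [hYg]; exact Set.mem_image_of_mem g hp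
    have hgq : g q ∈ Y := by rw [hYg]; exact Set.mem_image_of_mem g hq
    have hne : g p ≠ g q := fun h0 => hpq (g.injective h0)
    obtain ⟨p', hp', q', hq', hd⟩ := hD (g p) hgp (g q) hgq hne
    exact ⟨p', hp', q', hq', by rw [← hd, g.dist_eq]⟩
  -- … and P3 selects hcp; compose the two isometries.
  obtain ⟨g', hg'⟩ := stub_spectrumSelectsHcp a h ha hwin s hs hdistS
  refine ⟨g'.trans g, ?_⟩
  rw [hYg, hg', Set.image_image]
  rfl

end Summit.AtomisticToContinuum.Crystallization.Cruxes.SpectralRigidityHcp.ShellsSplit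

end
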